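import Summits.ValiantsHypothesis.ValiantsHypothesis.Theorems.KPlusLogSqLawTropicalBToeplitzTranslatedWindow

/-!
# Route `KPlusLogSqLaw`, crux `TropicalB` — Conjecture T: the co-size-one frame recursion `#(co-size-1 members) ≤ 4·Φ(m−1)`

HONEST FRAMING.  Helper toward the registered stubs `stub_tropThin` / `stub_tropFat` of
`Cruxes/TropicalB/Lines/birth.lean` (crux `Summit.ValiantsHypothesis.ValiantsHypothesis.Theses.KPlusLogSqLaw.TropicalB`,
ledger item `stmt-ValiantsHypothesis-19771`, route `KPlusLogSqLaw`; cell `pub-symmetroid`, seat `val-sym-trop-p3`,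
2026-08-26).  A recursion inequality for the cell's Conjecture T (linear Toeplitz instances), instantiating the translated
window machinery (`…ToeplitzTranslatedWindow`) at window size `m − 1`.  Nothing here bounds `Φ` absolutely, and nothing
bears on `TropicalB` for general designs, `KPlusLogSqLaw`, `MatrixDescartes` or `VP ≠ VNP`.

* `perm_cosizeOne_outside` — a permutation of `Fin (n+1)` mapping `[a, a+n)` into `[a', a'+n)` (`a, a' ≤ 1`) sends the
  position outside the window to the position outside the translate.
* `toeplitz_cosizeOne_chain_le` — along any chain in size `n + 1`, the members with a translated window of size `n` (four
  frame types `(a, a') ∈ {0,1}²`: a fixed end, or a «rotation-like» end) are at most `4·Φ`, for any `Φ` bounding the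
  chains at size `n` of the shifted instances `(ψ(·+t), α(·+t))`, `t ∈ {−1, 0, 1}`.  DATUM (located, seat scripts on the
  certified chains `…ToeplitzSix…Ten`): such members are the majority of every extremal chain (e.g. 17 of 28 at `m = 9`).

References: folklore; `toeplitz_translatedWindow_chain_le`, `card_finWindow`, `perm_not_mem_of_mapsTo_card`
(`…ToeplitzTranslatedWindow`).
-/

set_option linter.dupNamespace false
set_option autoImplicit false

namespace Summit.ValiantsHypothesis.ValiantsHypothesis.Theorems.KPlusLogSqLaw

open scoped BigOperators
open Finset

section CoSizeOne

variable {n : ℕ}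

/-- In `Fin (n+1)`, a permutation mapping the window `[a, a+n)` (`a ≤ 1`) into `[a', a'+n)` (`a' ≤ 1`) sends the one position
outside the window to the one position outside the translate. [folklore] -/
theorem perm_cosizeOne_outside (τ : Equiv.Perm (Fin (n + 1))) (a a' : ℕ) (ha : a ≤ 1) (ha' : a' ≤ 1)
    (hinv : ∀ b : Fin (n + 1), a ≤ (b : ℕ) → (b : ℕ) < a + n →
      a' ≤ ((τ b : Fin (n + 1)) : ℕ) ∧ ((τ b : Fin (n + 1)) : ℕ) < a' + n)
    (x : Fin (n + 1)) (hx : ¬ (a ≤ (x : ℕ) ∧ (x : ℕ) < a + n)) :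
    ((τ x : Fin (n + 1)) : ℕ) = (if a' = 0 then n else 0) := by
  have key := perm_not_mem_of_mapsTo_card τ
    (univ.filter fun y : Fin (n + 1) => a ≤ (y : ℕ) ∧ (y : ℕ) < a + n)
    (univ.filter fun y : Fin (n + 1) => a' ≤ (y : ℕ) ∧ (y : ℕ) < a' + n)
    (fun b hb => by
      simp only [mem_filter, mem_univ, true_and] at hb ⊢
      exact hinv b hb.1 hb.2)
    (by rw [card_finWindow a n (by omega), card_finWindow a' n (by omega)])
    x (by simpa using hx)
  simp only [mem_filter, mem_univ, true_and, not_and, not_lt] at key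
  have h := (τ x).isLt
  split_ifs with h0
  · subst h0
    by_contra hne
    have := key (Nat.zero_le _)
    omega
  · have : a' = 1 := by omega
    subst this
    by_contra hne
    have := key (by omega)
    omega

/-- **Co-size-one frames: a recursion inequality for Conjecture T.**  Along a chain of pairwise distinct admissible unique
maximisers in size `n + 1`, the members having a translated window of size `n` (i.e. `τ k` maps `[a, a+n)` into
`[a', a'+n)` for some `a, a' ∈ {0, 1}`) number at most `4·Φ`, where `Φ` bounds the chains at size `n` of the three shifted
instances `(ψ(· + t), α(· + t))`, `t ∈ {−1, 0, 1}` (with admissible sets `P(· + t)`): four frame types, each carrying at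
most `Φ` members by `toeplitz_translatedWindow_chain_le` (the one position outside the window is forced,
`perm_cosizeOne_outside`).  In the certified extremal chains most members are of this kind (e.g. 17 of 28 at `m = 9`).
[folklore] -/
theorem toeplitz_cosizeOne_chain_le (ψ α : ℤ → ℤ) (P : ℤ → Prop) {N : ℕ} (θ' : Fin (N + 1) → ℤ)
    (τ : Fin (N + 1) → Equiv.Perm (Fin (n + 1))) (hθ : StrictMono θ') (hinj : Function.Injective τ)
    (hτP : ∀ k b, P ((τ k b : ℤ) - b))
    (huniq : ∀ k (σ : Equiv.Perm (Fin (n + 1))), σ ≠ τ k → (∀ b, P ((σ b : ℤ) - b)) →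
      ∑ b, (θ' k * ψ ((σ b : ℤ) - b) + α ((σ b : ℤ) - b)) <
        ∑ b, (θ' k * ψ ((τ k b : ℤ) - b) + α ((τ k b : ℤ) - b)))
    (S : Finset (Fin (N + 1)))
    (hS : ∀ k ∈ S, ∃ a a' : ℕ, a ≤ 1 ∧ a' ≤ 1 ∧ ∀ b : Fin (n + 1), a ≤ (b : ℕ) → (b : ℕ) < a + n →
      a' ≤ ((τ k b : Fin (n + 1)) : ℕ) ∧ ((τ k b : Fin (n + 1)) : ℕ) < a' + n)
    (Φ : ℕ)
    (hΦ : ∀ (t : ℤ), -1 ≤ t → t ≤ 1 → ∀ (N' : ℕ) (θ'' : Fin (N' + 1) → ℤ) (τ'' : Fin (N' + 1) → Equiv.Perm (Fin n)),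
      StrictMono θ'' → Function.Injective τ'' → (∀ k j, P (((τ'' k j : ℤ) - (j : ℤ)) + t)) →
      (∀ k (σ' : Equiv.Perm (Fin n)), σ' ≠ τ'' k → (∀ j, P (((σ' j : ℤ) - (j : ℤ)) + t)) →
        ∑ j, (θ'' k * ψ (((σ' j : ℤ) - (j : ℤ)) + t) + α (((σ' j : ℤ) - (j : ℤ)) + t)) <
          ∑ j, (θ'' k * ψ (((τ'' k j : ℤ) - (j : ℤ)) + t) + α (((τ'' k j : ℤ) - (j : ℤ)) + t))) →
      N' + 1 ≤ Φ) :
    S.card ≤ 4 * Φ := by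
  classical
  -- the four frame types
  let T : ℕ → ℕ → Finset (Fin (N + 1)) := fun a a' => S.filter fun k =>
    ∀ b : Fin (n + 1), a ≤ (b : ℕ) → (b : ℕ) < a + n →
      a' ≤ ((τ k b : Fin (n + 1)) : ℕ) ∧ ((τ k b : Fin (n + 1)) : ℕ) < a' + n
  have hT : ∀ a a' : ℕ, a ≤ 1 → a' ≤ 1 → (T a a').card ≤ Φ := by
    intro a a' ha ha'
    refine toeplitz_translatedWindow_chain_le ψ α P θ' τ hθ hinj hτP huniq a a' n (by omega) (by omega) (T a a')
      (fun k hk => (mem_filter.mp hk).2) (fun k hk k' hk' x hx => ?_) Φ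
      (hΦ ((a' : ℤ) - a) (by omega) (by omega))
    exact Fin.ext (by
      rw [perm_cosizeOne_outside (τ k) a a' ha ha' (mem_filter.mp hk).2 x hx,
        perm_cosizeOne_outside (τ k') a a' ha ha' (mem_filter.mp hk').2 x hx])
  have hcover : S ⊆ T 0 0 ∪ T 0 1 ∪ T 1 0 ∪ T 1 1 := by
    intro k hk
    obtain ⟨a, a', ha, ha', hw⟩ := hS k hk
    simp only [mem_union, T, mem_filter]
    rcases Nat.le_one_iff_eq_zero_or_eq_one.mp ha with rfl | rfl <;>
      rcases Nat.le_one_iff_eq_zero_or_eq_one.mp ha' with rfl | rfl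
    · exact Or.inl (Or.inl (Or.inl ⟨hk, hw⟩))
    · exact Or.inl (Or.inl (Or.inr ⟨hk, hw⟩))
    · exact Or.inl (Or.inr ⟨hk, hw⟩)
    · exact Or.inr ⟨hk, hw⟩
  calc S.card ≤ (T 0 0 ∪ T 0 1 ∪ T 1 0 ∪ T 1 1).card := card_le_card hcover
    _ ≤ (T 0 0 ∪ T 0 1 ∪ T 1 0).card + (T 1 1).card := card_union_le _ _
    _ ≤ (T 0 0 ∪ T 0 1).card + (T 1 0).card + (T 1 1).card := by
        have := card_union_le (T 0 0 ∪ T 0 1) (T 1 0); omega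
    _ ≤ (T 0 0).card + (T 0 1).card + (T 1 0).card + (T 1 1).card := by
        have := card_union_le (T 0 0) (T 0 1); omega
    _ ≤ Φ + Φ + Φ + Φ := by
        have h1 := hT 0 0 (by norm_num) (by norm_num)
        have h2 := hT 0 1 (by norm_num) (by norm_num)
        have h3 := hT 1 0 (by norm_num) (by norm_num)
        have h4 := hT 1 1 (by norm_num) (by norm_num)
        omega
    _ = 4 * Φ := by ring

end CoSizeOne

end Summit.ValiantsHypothesis.ValiantsHypothesis.Theorems.KPlusLogSqLaw
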